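import Summits.KontsevichZagierPeriods.KontsevichZagierPeriods.Theses.HurwitzMicroSectors
import Summits.KontsevichZagierPeriods.KontsevichZagierPeriods.Theorems.HurwitzMicroSectorsNormalFormPrinciplePiBoxTransfer
import Summits.KontsevichZagierPeriods.KontsevichZagierPeriods.Theorems.HurwitzMicroSectorsNormalFormPrincipleVariants2200

/-! TTRL-lite variant V2256 of stmt-KontsevichZagierPeriods-3869

Variant V2256 = `stub_boxRigidity` (BoxRigidity: two representations on open unit boxes with integrands
of KZ's rational shape and equal values are KZ-equivalent) under the move `bound_nat:m'≤6` (the right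
dimension bounded, the left dimension `m` free). Verdict of the attempt seat: **open, and provably as
hard as the parent** — this file is the certificate, not a proof of the variant. A bound `m' ≤ k` (any
`k`, likewise `m ≤ k`) contains the instance `m' = 0` (resp. `m = 0`), and ONE frozen dimension is already
the whole leaf (`boxRigidityRight_iff`, `boxRigidityLeft_iff` of the V2200 certificate: compare with the
zero representation on the `0`-box to get BoxVanishing in every dimension, and BoxVanishing is
BoxRigidity by `boxRigidity_of_boxVanishing`). Hence `boxRigidityRightLe_iff` / `boxRigidityLeftLe_iff`:
the programmatic moves `bound_nat:m'≤k` / `bound_nat:m≤k` of this stub never produce an easier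
statement, and `KontsevichZagierPeriods → V2256 → KZ.PiLocalKernel`
(`stub_boxRigidity_var2256_of_statement`, `piLocalKernel_of_stub_boxRigidity_var2256`): the variant sits
between the Summit and Ayoub's localised kernel conjecture (open), so it is neither provable nor
refutable from the tree; with `KZ.PiCancellation` it is exactly the Summit
(`statement_iff_stub_boxRigidity_var2256_and_piCancellation`). (Contrast: the TWO-sided bound
`m, m' ≤ 1` is a theorem, `boxRigidity_of_le_one`, by Baker — only a joint bound can help.)
Source: M. Kontsevich, D. Zagier, *Periods* (2001), §1.2 Conjecture 1; J. Ayoub, EMS Newsl. 91 (2014),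
Conj. 7. Pure proof file, no definitions. -/

-- `Summit.<Summit>.<Problem>` is the tree's mandated summit-side namespace (CONVENTIONS §2); for this
-- single-conjunct summit the two coincide, so the duplicate is deliberate.
set_option linter.dupNamespace false

noncomputable section

namespace Summit.KontsevichZagierPeriods.KontsevichZagierPeriods.Theorems

open MeasureTheory Set
open Literature.NumberTheory.Transcendental Literature.NumberTheory.Transcendental.KZ
open Summit.KontsevichZagierPeriods.KontsevichZagierPeriods.Theses.HurwitzMicroSectors
open Summit.KontsevichZagierPeriods.HurwitzMicroSectors.NormalFormPrinciple.PiBox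

/-! ## A bounded dimension is as strong as a free one -/

/-- **`BoxRigidity` with the right dimension bounded (`m' ≤ k`) ⟺ `BoxRigidity`**: the bounded family
contains the instance `m' = 0`, which is the whole leaf by `boxRigidityRight_iff 0`.
[cite: KontsevichZagier2001, §1.2 Conjecture 1] -/
theorem boxRigidityRightLe_iff (k : ℕ) :
    (∀ (m m' : ℕ) (N : IntegralRep m) (N' : IntegralRep m'), m' ≤ k →
      N.domain = {x | ∀ i, x i ∈ Set.Ioo (0:ℝ) 1} → N.IsRational →
      N'.domain = {x | ∀ i, x i ∈ Set.Ioo (0:ℝ) 1} → N'.IsRational →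
      N.value = N'.value → Equivalent N N') ↔
    (∀ (m m' : ℕ) (N : IntegralRep m) (N' : IntegralRep m'),
      N.domain = {x | ∀ i, x i ∈ Set.Ioo (0:ℝ) 1} → N.IsRational →
      N'.domain = {x | ∀ i, x i ∈ Set.Ioo (0:ℝ) 1} → N'.IsRational →
      N.value = N'.value → Equivalent N N') :=
  ⟨fun h => (boxRigidityRight_iff 0).1 fun m N N' => h m 0 N N' (Nat.zero_le k),
    fun h m m' N N' _ => h m m' N N'⟩

/-- **`BoxRigidity` with the left dimension bounded (`m ≤ k`) ⟺ `BoxRigidity`** (the move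
`bound_nat:m≤k`; instance `m = 0` and `boxRigidityLeft_iff 0`). [cite: KontsevichZagier2001, §1.2 Conjecture 1] -/
theorem boxRigidityLeftLe_iff (k : ℕ) :
    (∀ (m m' : ℕ) (N : IntegralRep m) (N' : IntegralRep m'), m ≤ k →
      N.domain = {x | ∀ i, x i ∈ Set.Ioo (0:ℝ) 1} → N.IsRational →
      N'.domain = {x | ∀ i, x i ∈ Set.Ioo (0:ℝ) 1} → N'.IsRational →
      N.value = N'.value → Equivalent N N') ↔
    (∀ (m m' : ℕ) (N : IntegralRep m) (N' : IntegralRep m'),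
      N.domain = {x | ∀ i, x i ∈ Set.Ioo (0:ℝ) 1} → N.IsRational →
      N'.domain = {x | ∀ i, x i ∈ Set.Ioo (0:ℝ) 1} → N'.IsRational →
      N.value = N'.value → Equivalent N N') :=
  ⟨fun h => (boxRigidityLeft_iff 0).1 fun m' N N' => h 0 m' N N' (Nat.zero_le k),
    fun h m m' N N' _ => h m m' N N'⟩

/-! ## The variant V2256 itself: between the Summit and `KZ.PiLocalKernel` -/

/-- **V2256 ⟺ the parent leaf `BoxRigidity`** (instance `k = 6` of `boxRigidityRightLe_iff`).
[cite: KontsevichZagier2001, §1.2 Conjecture 1] -/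
theorem stub_boxRigidity_var2256_iff_parent :
    (∀ (m m' : ℕ) (N : IntegralRep m) (N' : IntegralRep m'), m' ≤ 6 → N.domain = {x | ∀ i, x i ∈ Set.Ioo (0:ℝ) 1} → N.IsRational → N'.domain = {x | ∀ i, x i ∈ Set.Ioo (0:ℝ) 1} → N'.IsRational → N.value = N'.value → Equivalent N N') ↔
    (∀ (m m' : ℕ) (N : IntegralRep m) (N' : IntegralRep m'), N.domain = {x | ∀ i, x i ∈ Set.Ioo (0:ℝ) 1} → N.IsRational → N'.domain = {x | ∀ i, x i ∈ Set.Ioo (0:ℝ) 1} → N'.IsRational → N.value = N'.value → Equivalent N N') :=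
  boxRigidityRightLe_iff 6

/-- **V2256 ⇒ `KZ.PiLocalKernel`** (Ayoub's localised kernel conjecture for this calculus — open): a
proof of the variant would settle an open conjecture of the tree. [cite: Ayoub2014, Def. 6 and Conj. 7] -/
theorem piLocalKernel_of_stub_boxRigidity_var2256
    (h : ∀ (m m' : ℕ) (N : IntegralRep m) (N' : IntegralRep m'), m' ≤ 6 → N.domain = {x | ∀ i, x i ∈ Set.Ioo (0:ℝ) 1} → N.IsRational → N'.domain = {x | ∀ i, x i ∈ Set.Ioo (0:ℝ) 1} → N'.IsRational → N.value = N'.value → Equivalent N N') :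
    PiLocalKernel :=
  piLocalKernel_of_boxRigidity (stub_boxRigidity_var2256_iff_parent.1 h)

/-- **`KontsevichZagierPeriods ⇒ V2256`**: the variant is a special case of Conjecture 1 for the
tree's calculus — a refutation of the variant would refute the Summit. [cite: KontsevichZagier2001, §1.2 Conjecture 1] -/
theorem stub_boxRigidity_var2256_of_statement (h : _root_.KontsevichZagierPeriods) :
    ∀ (m m' : ℕ) (N : IntegralRep m) (N' : IntegralRep m'), m' ≤ 6 → N.domain = {x | ∀ i, x i ∈ Set.Ioo (0:ℝ) 1} → N.IsRational → N'.domain = {x | ∀ i, x i ∈ Set.Ioo (0:ℝ) 1} → N'.IsRational → N.value = N'.value → Equivalent N N' :=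
  fun m m' N N' _ => (leaves_of_statement h).1 m m' N N'

/-- **Summit ⟺ V2256 ∧ PiCancellation** (from `statement_iff_leaves`): with `π`-cancellation the variant
is exactly what the Summit needs, no more and no less. [cite: KontsevichZagier2001, §1.2 Conjecture 1] -/
theorem statement_iff_stub_boxRigidity_var2256_and_piCancellation :
    _root_.KontsevichZagierPeriods ↔
    ((∀ (m m' : ℕ) (N : IntegralRep m) (N' : IntegralRep m'), m' ≤ 6 → N.domain = {x | ∀ i, x i ∈ Set.Ioo (0:ℝ) 1} → N.IsRational → N'.domain = {x | ∀ i, x i ∈ Set.Ioo (0:ℝ) 1} → N'.IsRational → N.value = N'.value → Equivalent N N') ∧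
      PiCancellation) := by
  rw [statement_iff_leaves, stub_boxRigidity_var2256_iff_parent]

end Summit.KontsevichZagierPeriods.KontsevichZagierPeriods.Theorems
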